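import Summits.HubbardSuperconductivity.HubbardSuperconductivity.Theses.WeakCouplingBCS
import Literature.MathematicalPhysics.QuantumLattice.PairFieldMomentum
import Literature.MathematicalPhysics.QuantumLattice.PairCorrelationsProofs
import Literature.MathematicalPhysics.QuantumLattice.ApproximateEigenvectorLemmas
import Literature.MathematicalPhysics.QuantumLattice.HubbardWave0PosSemidefProofs

/-!
# Crux `WcbcsSsbToTorusLRO` (item `stmt-HubbardSuperconductivity-2009`): the Kac block repulsion of the promoted
stub `stub_facePurityChord` DOMINATES the pair order — negative-side support from the standing disprover
(generation 4), file 2 of 4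

The lead's one open stub of line `tangent-face-legendre-spine` (route `WeakCouplingBCS`, crux rank 2) perturbs
`hubbardTorus 2 L 1 U` by `κ · W_R`, `W_R = R⁻⁴ Σ_a B_aᴴ B_a`, `B_a = Σ_{u ∈ [0,R)²} P_{a+u}` (blocks of side `R`
at every anchor `a` of the torus, wrapping around; `P_x = localPair dWaveFormFactor L x`). On the LITERAL syntax
of the stub (every statement written out; no definitions):

* `sum_blockPair` — `Σ_a B_a = R² · P`, `P = pairField dWaveFormFactor L` (every site is covered by `R²`
  translates of the block);
* `re_expect_blockRepulsion` — `re⟨ψ, W_R ψ⟩ = R⁻⁴ · re Σ_a ‖B_a ψ‖²` (shape of the landed Fejér closure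
  `Theorems/WeakCouplingBCSWcbcsSsbToTorusLROFejerClosure.lean`);
* `re_expect_pairIntensity_le_sq_mul_blockRepulsion` — **block coherence dominates pair order at every scale**:
  `re⟨ψ, P†P ψ⟩ ≤ L² · re⟨ψ, W_R ψ⟩` for every vector and every `R ≥ 1` (Cauchy–Schwarz over the `L²` anchors);
  so an every-ground-state PAIR-ORDER floor (the summit matrix, file 1) is already an every-ground-state
  BLOCK-COHERENCE floor at all scales (file 3);
* `blockPair_self`, `blockRepulsion_self`, `re_expect_blockRepulsion_self` — TIGHTNESS: at `R = L` every block is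
  the whole torus, `W_L = L⁻² P†P`, and the inequality is an equality.

Folklore finite sums and the discrete Cauchy–Schwarz inequality (`sq_sum_le_card_mul_sum_sq`). Workfile:
`Cruxes/WcbcsSsbToTorusLRO/Disproof.lean` §15.
-/

noncomputable section

namespace Summit.HubbardSuperconductivity.WcbcsSsbToTorusLRO.Negative

open Matrix Literature.MathematicalPhysics.QuantumLattice
open Filter Set
open scoped Matrix ComplexOrder Matrix.Norms.L2Operator

variable (L : ℕ) [NeZero L]

/-- `Σ_a B_a = R² · P` (every site is covered by exactly `R²` translates of the block). [folklore] -/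
theorem sum_blockPair (R : ℕ) :
    ∑ a : Literature.Probability.LatticeModels.TorusSite 2 L, (∑ u : Fin 2 → Fin R, localPair dWaveFormFactor L (a + fun i => ((u i : ℕ) : ZMod L))) = ((R : ℂ) ^ 2) • pairField dWaveFormFactor L := by
  have key : ∀ u : Fin 2 → Fin R,
      ∑ a : Literature.Probability.LatticeModels.TorusSite 2 L,
        localPair dWaveFormFactor L (a + fun i => ((u i : ℕ) : ZMod L)) = pairField dWaveFormFactor L := by
    intro u
    exact Fintype.sum_equiv (Equiv.addRight (fun i => ((u i : ℕ) : ZMod L))) _ _ (fun a => rfl)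
  rw [Finset.sum_comm]
  simp only [key, Finset.sum_const, Finset.card_univ, Fintype.card_pi, Fintype.card_fin, Finset.prod_const]
  rw [← Nat.cast_smul_eq_nsmul ℂ]
  push_cast
  rfl

omit [NeZero L] in
/-- Cauchy–Schwarz over a finite family of vectors: `‖Σ_a v_a‖² ≤ |s| · Σ_a ‖v_a‖²`. [folklore] -/
theorem re_star_sum_dotProduct_sum_le {α n : Type*} [Fintype n] (s : Finset α) (v : α → n → ℂ) :
    (star (∑ a ∈ s, v a) ⬝ᵥ (∑ a ∈ s, v a)).re ≤ s.card * ∑ a ∈ s, (star (v a) ⬝ᵥ v a).re := by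
  have h1 : eucNorm (∑ a ∈ s, v a) ≤ ∑ a ∈ s, eucNorm (v a) :=
    Finset.le_sum_of_subadditive eucNorm eucNorm_zero.le eucNorm_add_le s v
  have h2 : (∑ a ∈ s, eucNorm (v a)) ^ 2 ≤ s.card * ∑ a ∈ s, eucNorm (v a) ^ 2 :=
    sq_sum_le_card_mul_sum_sq
  rw [← eucNorm_sq]
  simp_rw [← eucNorm_sq]
  exact (pow_le_pow_left₀ (eucNorm_nonneg _) h1 2).trans h2

/-- `re⟨ψ, W_R ψ⟩ = R⁻⁴ · re Σ_a ‖B_a ψ‖²` (shape of the landed Fejér closure: `re` outside the sum). [folklore] -/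
theorem re_expect_blockRepulsion (R : ℕ) (ψ : Finset (Orb (FermionTorus 2 L)) → ℂ) :
    (star ψ ⬝ᵥ (((((R : ℝ) ^ 4)⁻¹ : ℝ) : ℂ) • ∑ a : Literature.Probability.LatticeModels.TorusSite 2 L, ((∑ u : Fin 2 → Fin R, localPair dWaveFormFactor L (a + fun i => ((u i : ℕ) : ZMod L))))ᴴ * ((∑ u : Fin 2 → Fin R, localPair dWaveFormFactor L (a + fun i => ((u i : ℕ) : ZMod L))))) *ᵥ ψ).re =
      ((R : ℝ) ^ 4)⁻¹ *
        (∑ a : Literature.Probability.LatticeModels.TorusSite 2 L, star ((∑ u : Fin 2 → Fin R, localPair dWaveFormFactor L (a + fun i => ((u i : ℕ) : ZMod L))) *ᵥ ψ) ⬝ᵥ ((∑ u : Fin 2 → Fin R, localPair dWaveFormFactor L (a + fun i => ((u i : ℕ) : ZMod L))) *ᵥ ψ)).re := by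
  rw [Matrix.smul_mulVec, dotProduct_smul, smul_eq_mul, Complex.re_ofReal_mul, Matrix.sum_mulVec, dotProduct_sum]
  congr 2
  refine Finset.sum_congr rfl fun a _ => ?_
  rw [Literature.MathematicalPhysics.QuantumLattice.star_mulVec_dotProduct_mulVec]

/-- `card (TorusSite 2 L) = L²`. [folklore] -/
theorem card_torusSite_two : Fintype.card (Literature.Probability.LatticeModels.TorusSite 2 L) = L ^ 2 := by
  simp [Fintype.card_pi, ZMod.card, Finset.prod_const]

/-- **Block coherence dominates pair order at every scale**: `re⟨ψ, P†P ψ⟩ ≤ L² · re⟨ψ, W_R ψ⟩` for every vector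
(`R ≥ 1`). Proof: `R⁴ ‖Pψ‖² = ‖Σ_a B_a ψ‖² ≤ L² Σ_a ‖B_a ψ‖²`. [folklore] -/
theorem re_expect_pairIntensity_le_sq_mul_blockRepulsion (R : ℕ) (hR : 0 < R)
    (ψ : Finset (Orb (FermionTorus 2 L)) → ℂ) :
    (expect ((pairField dWaveFormFactor L)ᴴ * pairField dWaveFormFactor L) ψ).re ≤ (L : ℝ) ^ 2 * (star ψ ⬝ᵥ (((((R : ℝ) ^ 4)⁻¹ : ℝ) : ℂ) • ∑ a : Literature.Probability.LatticeModels.TorusSite 2 L, ((∑ u : Fin 2 → Fin R, localPair dWaveFormFactor L (a + fun i => ((u i : ℕ) : ZMod L))))ᴴ * ((∑ u : Fin 2 → Fin R, localPair dWaveFormFactor L (a + fun i => ((u i : ℕ) : ZMod L))))) *ᵥ ψ).re := by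
  have hRr : (0 : ℝ) < (R : ℝ) := by exact_mod_cast hR
  rw [re_expect_blockRepulsion, Complex.re_sum]
  have hcs := re_star_sum_dotProduct_sum_le Finset.univ (fun a => (∑ u : Fin 2 → Fin R, localPair dWaveFormFactor L (a + fun i => ((u i : ℕ) : ZMod L))) *ᵥ ψ)
  have hsum : ∑ a : Literature.Probability.LatticeModels.TorusSite 2 L, (∑ u : Fin 2 → Fin R, localPair dWaveFormFactor L (a + fun i => ((u i : ℕ) : ZMod L))) *ᵥ ψ =
      ((R : ℂ) ^ 2) • (pairField dWaveFormFactor L *ᵥ ψ) := by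
    rw [← Matrix.sum_mulVec, sum_blockPair, Matrix.smul_mulVec]
  have hsq : (star (((R : ℂ) ^ 2) • (pairField dWaveFormFactor L *ᵥ ψ)) ⬝ᵥ (((R : ℂ) ^ 2) • (pairField dWaveFormFactor L *ᵥ ψ))).re =
      (R : ℝ) ^ 4 * (expect ((pairField dWaveFormFactor L)ᴴ * pairField dWaveFormFactor L) ψ).re := by
    rw [← eucNorm_sq, eucNorm_smul, mul_pow, eucNorm_sq, ← PosSemidefTrace.expect_conjTranspose_mul]
    have e1 : ‖(R : ℂ) ^ 2‖ ^ 2 = (R : ℝ) ^ 4 := by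
      rw [norm_pow, Complex.norm_natCast]; ring
    rw [e1]
  simp only [hsum, Finset.card_univ, card_torusSite_two, Nat.cast_pow] at hcs
  rw [hsq] at hcs
  -- hcs : R⁴ · re⟨P†P⟩ ≤ L² · Σ_a ‖B_a ψ‖²
  set S : ℝ := ∑ a : Literature.Probability.LatticeModels.TorusSite 2 L,
    (star ((∑ u : Fin 2 → Fin R, localPair dWaveFormFactor L (a + fun i => ((u i : ℕ) : ZMod L))) *ᵥ ψ) ⬝ᵥ ((∑ u : Fin 2 → Fin R, localPair dWaveFormFactor L (a + fun i => ((u i : ℕ) : ZMod L))) *ᵥ ψ)).re with hS_def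
  have hR4 : (0 : ℝ) < (R : ℝ) ^ 4 := by positivity
  have e5 : (L : ℝ) ^ 2 * (((R : ℝ) ^ 4)⁻¹ * S) = ((R : ℝ) ^ 4)⁻¹ * ((L : ℝ) ^ 2 * S) := by ring
  rw [e5, ← div_eq_inv_mul, le_div_iff₀ hR4, mul_comm]
  exact hcs

/-! ### Tightness at `R = L` -/

/-- At block scale `R = L` every block is the whole torus: `B_a = P` for every anchor. [folklore] -/
theorem blockPair_self (a : Literature.Probability.LatticeModels.TorusSite 2 L) : (∑ u : Fin 2 → Fin L, localPair dWaveFormFactor L (a + fun i => ((u i : ℕ) : ZMod L))) = pairField dWaveFormFactor L := by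
  obtain ⟨n, rfl⟩ : ∃ n, L = n + 1 := ⟨L - 1, by have := NeZero.ne L; omega⟩
  have hcast : ∀ u : Fin 2 → Fin (n + 1),
      (fun i => (((u i : ℕ) : ZMod (n + 1)))) = (u : Literature.Probability.LatticeModels.TorusSite 2 (n + 1)) := by
    intro u
    funext i
    exact Fin.cast_val_eq_self (u i)
  simp_rw [hcast]
  exact Fintype.sum_equiv (Equiv.addLeft a) _ _ (fun u => rfl)

/-- Hence `W_L = L⁻² P†P` … [folklore] -/
theorem blockRepulsion_self : (((((L : ℝ) ^ 4)⁻¹ : ℝ) : ℂ) • ∑ a : Literature.Probability.LatticeModels.TorusSite 2 L, ((∑ u : Fin 2 → Fin L, localPair dWaveFormFactor L (a + fun i => ((u i : ℕ) : ZMod L))))ᴴ * ((∑ u : Fin 2 → Fin L, localPair dWaveFormFactor L (a + fun i => ((u i : ℕ) : ZMod L))))) = ((((L : ℝ) ^ 2)⁻¹ : ℝ) : ℂ) • ((pairField dWaveFormFactor L)ᴴ * pairField dWaveFormFactor L) := by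
  have hL : (L : ℂ) ≠ 0 := Nat.cast_ne_zero.2 (NeZero.ne L)
  simp only [blockPair_self, Finset.sum_const, Finset.card_univ, card_torusSite_two]
  rw [← Nat.cast_smul_eq_nsmul ℂ, smul_smul]
  congr 1
  push_cast
  field_simp

/-- … and the domination inequality is an EQUALITY at `R = L`: `L² · re⟨ψ, W_L ψ⟩ = re⟨ψ, P†P ψ⟩`. (So the
every-GS block-coherence floor at scale `R = L` would be the pair-order floor itself; it is the order of
quantifiers `∀ R, ∀ᶠ k` of the stub — `R` fixed while `L → ∞` — that makes the infrared leak necessary for the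
converse direction of file 3.) [folklore] -/
theorem re_expect_blockRepulsion_self (ψ : Finset (Orb (FermionTorus 2 L)) → ℂ) :
    (L : ℝ) ^ 2 * (star ψ ⬝ᵥ (((((L : ℝ) ^ 4)⁻¹ : ℝ) : ℂ) • ∑ a : Literature.Probability.LatticeModels.TorusSite 2 L, ((∑ u : Fin 2 → Fin L, localPair dWaveFormFactor L (a + fun i => ((u i : ℕ) : ZMod L))))ᴴ * ((∑ u : Fin 2 → Fin L, localPair dWaveFormFactor L (a + fun i => ((u i : ℕ) : ZMod L))))) *ᵥ ψ).re = (expect ((pairField dWaveFormFactor L)ᴴ * pairField dWaveFormFactor L) ψ).re := by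
  have hL : (0 : ℝ) < (L : ℝ) := Nat.cast_pos.2 (Nat.pos_of_ne_zero (NeZero.ne L))
  rw [blockRepulsion_self, Matrix.smul_mulVec, dotProduct_smul, smul_eq_mul, Complex.re_ofReal_mul]
  unfold expect
  field_simp

end Summit.HubbardSuperconductivity.WcbcsSsbToTorusLRO.Negative

end
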